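import Summits.BirchSwinnertonDyer.Rank1Residual.X2.GreenbergVatsalTateFrobeniusSign
import Summits.BirchSwinnertonDyer.Rank1Residual.X11a.SelmerCompanionKindsAtTwo
import HarnessLib

/-!
# T-42-mult in the kernel, I-a: an arithmetic Frobenius FLIPS `√γ(E)` at a NON-SPLIT multiplicative `2`

Cell `bsd-2adic` (run/shared/lean/pub/bsd-2adic/), seat `bsd-2adic-t42` (BRIEF-T42, DESIGN-T42 §5 item
T2): the `p = 2` port of b2b's `X2.GreenbergVatsalTateFrobeniusSign.frob_smul_sqrt_gamma_eq_neg` (odd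
`p`, Euler's criterion), toward the kernel theorem discharging the displayed transport
`X5.O1.MultCongruenceTransportAtTwo` (Matsuno's method at a multiplicative `2`). HONEST FRAMING: research
route; theorems only (no `def`, no named fact, nothing booked).

WHAT THIS FILE PROVES (`E/ℚ` globally minimal, MULTIPLICATIVE and NOT split at `2`, `v ∋ 2`,
`t² = γ = −c₄/c₆`): `odd_a₁_of_not_two_dvd_c₄`, `nodal_root_zero_of_two_dvd` (bookkeeping) and
**`frob_smul_sqrt_gamma_eq_neg_two`** / `frob_apply_sqrt_gamma_ne_two`: every arithmetic Frobenius
`τ ∈ Γ_{ℚ₂}` satisfies `τ t = −t`. Proof (the `2`-adic substitute for Euler's criterion):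
`T₀ = (c₆ t − a₁c₄)/(2c₄)` is a root of the node-tangent quadratic `c₄T² + a₁c₄T − C`,
`C = 54b₆ − 3b₂b₄ + a₂c₄` (discriminant `−c₄c₆`, tree `WeierstrassCurve.discrim_nodalTangents`), hence a
`v`-adic integer; `τT₀ ≡ T₀² (mod 𝔐)`; if `τ t = t` then `τ T₀ = T₀`, so `|(1 + a₁)T₀ − C/c₄|_v < 1`
with `a₁` odd, so `2 ∣ C`: then `T = 0` is a root of the node-tangent quadratic mod `2` and the
reduction is SPLIT (tree `IntModel.hasSplitMultiplicativeReductionAtPrime_of_intModel_of_root`).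
Also `absInertia_fix_sqrt_gamma_two`: b2b's `X11a.SelmerCompanion.inertia_fix_sqrt_gamma_two` moved to
`absInertia` (`inertia_eq_absInertia`). So `ℚ₂(√γ)/ℚ₂` is exactly the unramified quadratic extension at
a non-split `2` (Silverman *ATAEC* V Ex. 5.11 (b), now at `p = 2`).

References: [SilvermanATAEC1994] V.5.2–5.4, Ex. 5.11; [SilvermanAEC2009] VII.5.1(b); [NeukirchANT1999]
II (9.3); [GreenbergVatsal2000] §2 pp. 14–15 (odd `p` original).
-/

set_option autoImplicit false

set_option linter.dupNamespace false

noncomputable section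

open scoped Classical AddSubgroup NNReal

universe u

namespace Summit.BirchSwinnertonDyer.BirchSwinnertonDyer.Theorems.MultTransportAtTwo

open NumberField IsDedekindDomain Field Polynomial Literature.NumberTheory.GaloisRepresentations
  Literature.NumberTheory.EllipticCurves Literature.NumberTheory.EllipticCurves.GreenbergSelmer
  Literature.NumberTheory.EllipticCurves.GreenbergVatsal2000
  Literature.NumberTheory.EllipticCurves.Greenberg1999
  Literature.NumberTheory.EllipticCurves.ResKernel IsDedekindDomain.HeightOneSpectrum
  Rat.HeightOneSpectrum
  Summit.BirchSwinnertonDyer.Rank1Residual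
  Summit.BirchSwinnertonDyer.Rank1Residual.X2
  Summit.BirchSwinnertonDyer.Rank1Residual.X2.GreenbergVatsalReductionDatum
open WeierstrassCurve (minimalDiscriminantInt integralModelInt)

/-! ## §1. An arithmetic Frobenius flips `√γ` at a NON-SPLIT multiplicative `2` -/

section Flip

variable (W : WeierstrassCurve ℚ) [W.IsElliptic] [W.IsGloballyMinimal] {v : HeightOneSpectrum (𝓞 ℚ)}

/-- `a₁` is odd when `c₄` is odd (integral Weierstrass equation): `c₄ = b₂² − 24b₄` odd forces
`b₂ = a₁² + 4a₂` odd. Silverman, *AEC* III.1. [folklore] -/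
theorem odd_a₁_of_not_two_dvd_c₄ (V : WeierstrassCurve ℤ) (h : ¬ (2 : ℤ) ∣ V.c₄) : Odd V.a₁ := by
  rcases Int.even_or_odd V.a₁ with ⟨m, hm⟩ | hodd
  · exfalso
    apply h
    refine ⟨8 * (m ^ 2 + V.a₂) ^ 2 - 12 * V.b₄, ?_⟩
    rw [WeierstrassCurve.c₄, WeierstrassCurve.b₂, hm]
    ring
  · exact hodd

/-- If `a₁` is odd and the node-tangent constant `C = 54b₆ − 3b₂b₄ + a₂c₄` is even then `T = 0` is a
root of the node-tangent quadratic `c₄T² + a₁c₄T − C` modulo `2`. Silverman, *AEC* VII.5.1(b) (the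
quadratic). [folklore] -/
theorem nodal_root_zero_of_two_dvd (V : WeierstrassCurve ℤ)
    (hC : (2 : ℤ) ∣ 54 * V.b₆ - 3 * V.b₂ * V.b₄ + V.a₂ * V.c₄) :
    ∃ t : ZMod 2, (V.c₄ : ZMod 2) * t ^ 2 + (V.a₁ * V.c₄ : ZMod 2) * t
      - (54 * V.b₆ - 3 * V.b₂ * V.b₄ + V.a₂ * V.c₄ : ZMod 2) = 0 := by
  refine ⟨0, ?_⟩
  have h0 : ((54 * V.b₆ - 3 * V.b₂ * V.b₄ + V.a₂ * V.c₄ : ℤ) : ZMod 2) = 0 :=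
    (ZMod.intCast_zmod_eq_zero_iff_dvd _ 2).2 hC
  push_cast at h0
  linear_combination (-1 : ZMod 2) * h0

/-- **An arithmetic Frobenius FLIPS `√γ(E)` at a NON-SPLIT multiplicative `2`.** For the globally
minimal `E/ℚ`, multiplicative and NOT split at `2`, `v ∋ 2`, `𝔐` a prime of `\bar 𝓞_v` above `𝓂_v`,
`τ ∈ Γ_{ℚ_v}` an arithmetic Frobenius at `𝔐` (`τ x ≡ x² (mod 𝔐)`), and `t ∈ ℚ̄_v` with
`t² = γ = −c₄/c₆`: `τ(t) = −t`. The `2`-adic replacement of Euler's criterion: the root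
`T₀ = (c₆t − a₁c₄)/(2c₄)` of the node-tangent quadratic is a `v`-adic integer with `τT₀ ≡ T₀²`; were
`τ t = t`, then `|(1 + a₁)T₀ − C/c₄|_v = |T₀ − T₀²|_v < 1` with `a₁` odd, so `2 ∣ C` and `T = 0` is a
root of the node-tangent quadratic mod `2`, i.e. the reduction is split. Equivalently `ℚ₂(√γ)` is the
unramified QUADRATIC extension of `ℚ₂` at a non-split `2` (Silverman *ATAEC* V Ex. 5.11 (b)).
[cite: SilvermanATAEC1994, Ch. V Lemma 5.2 (c), Thm. 5.3 (a),(b), Cor. 5.4, Ex. 5.11]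
[cite: SilvermanAEC2009, VII.5 Prop. 5.1(b)] -/
theorem frob_smul_sqrt_gamma_eq_neg_two (hmult : W.HasMultiplicativeReductionAtPrime 2)
    (hns : ¬ W.HasSplitMultiplicativeReductionAtPrime 2) (h2v : ((2 : ℕ) : 𝓞 ℚ) ∈ v.asIdeal)
    {𝔐 : Ideal v.localAbsIntegers} (h𝔐 : 𝔐 ∈ v.localPrimesAbove)
    {τ : absoluteGaloisGroup (v.adicCompletion ℚ)}
    (hτ : IsArithFrobAt (v.adicCompletionIntegers ℚ) τ 𝔐)
    (t : AlgebraicClosure (v.adicCompletion ℚ))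
    (ht : t ^ 2 = algebraMap (v.adicCompletion ℚ) (AlgebraicClosure (v.adicCompletion ℚ))
      (algebraMap ℚ (v.adicCompletion ℚ) (-(W.c₄ / W.c₆)))) :
    τ • t = -t := by
  haveI : CharZero (AlgebraicClosure (v.adicCompletion ℚ)) :=
    charZero_of_injective_algebraMap (algebraMap ℚ (AlgebraicClosure (v.adicCompletion ℚ))).injective
  obtain ⟨w, hw⟩ := v.exists_spectralValuation
  obtain ⟨hΔ, hc₄⟩ := Additive.dvd_and_not_dvd_c₄_of_hasMultiplicativeReductionAtPrime W 2 hmult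
  have hc₆ := X2.GreenbergVatsalTateDatumRat.not_dvd_c₆_of_hasMultiplicativeReductionAtPrime W hmult
  rw [Nat.cast_ofNat] at hΔ hc₄ hc₆
  set E₀ := integralModelInt W with hE₀
  have h4 : W.c₄ = (E₀.c₄ : ℚ) := by
    conv_lhs => rw [← WeierstrassCurve.map_integralModelInt W]
    rw [WeierstrassCurve.map_c₄, eq_intCast]
  have h6 : W.c₆ = (E₀.c₆ : ℚ) := by
    conv_lhs => rw [← WeierstrassCurve.map_integralModelInt W]
    rw [WeierstrassCurve.map_c₆, eq_intCast]
  have hγ : algebraMap (v.adicCompletion ℚ) (AlgebraicClosure (v.adicCompletion ℚ)) (algebraMap ℚ (v.adicCompletion ℚ) (-(W.c₄ / W.c₆))) =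
      -(((E₀.c₄ : ℤ) : AlgebraicClosure (v.adicCompletion ℚ)) / ((E₀.c₆ : ℤ) : AlgebraicClosure (v.adicCompletion ℚ))) := by
    rw [← IsScalarTower.algebraMap_apply ℚ (v.adicCompletion ℚ)
      (AlgebraicClosure (v.adicCompletion ℚ)), h4, h6, map_neg, map_div₀,
      map_intCast, map_intCast]
  have hw4 : w ((E₀.c₄ : ℤ) : AlgebraicClosure (v.adicCompletion ℚ)) = 1 :=
    spectralValuation_intCast_eq_one_of_natCast_mem h2v hw (by rwa [Nat.cast_ofNat])
  have hw6 : w ((E₀.c₆ : ℤ) : AlgebraicClosure (v.adicCompletion ℚ)) = 1 :=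
    spectralValuation_intCast_eq_one_of_natCast_mem h2v hw (by rwa [Nat.cast_ofNat])
  have hc₄0 : ((E₀.c₄ : ℤ) : AlgebraicClosure (v.adicCompletion ℚ)) ≠ 0 := by
    intro h0; rw [h0, map_zero] at hw4; exact zero_ne_one hw4
  have hc₆0 : ((E₀.c₆ : ℤ) : AlgebraicClosure (v.adicCompletion ℚ)) ≠ 0 := by
    intro h0; rw [h0, map_zero] at hw6; exact zero_ne_one hw6
  have h20 : (2 : AlgebraicClosure (v.adicCompletion ℚ)) ≠ 0 := two_ne_zero
  -- `a₁` is odd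
  obtain ⟨m, hm⟩ := odd_a₁_of_not_two_dvd_c₄ E₀ hc₄
  -- the node-tangent constant and the root `T₀`
  set C : ℤ := 54 * E₀.b₆ - 3 * E₀.b₂ * E₀.b₄ + E₀.a₂ * E₀.c₄ with hCdef
  have hdisc : (E₀.a₁ * E₀.c₄) ^ 2 + 4 * E₀.c₄ * C = -(E₀.c₄ * E₀.c₆) := by
    have h := WeierstrassCurve.discrim_nodalTangents E₀
    rw [discrim] at h
    rw [hCdef]
    linear_combination h
  set T₀ : AlgebraicClosure (v.adicCompletion ℚ) := (((E₀.c₆ : ℤ) : AlgebraicClosure (v.adicCompletion ℚ)) * t - ((E₀.a₁ : ℤ) : AlgebraicClosure (v.adicCompletion ℚ)) * ((E₀.c₄ : ℤ) : AlgebraicClosure (v.adicCompletion ℚ))) /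
    (2 * ((E₀.c₄ : ℤ) : AlgebraicClosure (v.adicCompletion ℚ))) with hT₀
  -- `T₀² + a₁ T₀ = C / c₄`
  have hT₀eq : T₀ ^ 2 + ((E₀.a₁ : ℤ) : AlgebraicClosure (v.adicCompletion ℚ)) * T₀ = ((C : ℤ) : AlgebraicClosure (v.adicCompletion ℚ)) / ((E₀.c₄ : ℤ) : AlgebraicClosure (v.adicCompletion ℚ)) := by
    have hd : (((E₀.a₁ : ℤ) : AlgebraicClosure (v.adicCompletion ℚ)) * ((E₀.c₄ : ℤ) : AlgebraicClosure (v.adicCompletion ℚ))) ^ 2 + 4 * ((E₀.c₄ : ℤ) : AlgebraicClosure (v.adicCompletion ℚ)) * ((C : ℤ) : AlgebraicClosure (v.adicCompletion ℚ)) =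
        -(((E₀.c₄ : ℤ) : AlgebraicClosure (v.adicCompletion ℚ)) * ((E₀.c₆ : ℤ) : AlgebraicClosure (v.adicCompletion ℚ))) := by
      have h := congrArg (fun z : ℤ ↦ (z : AlgebraicClosure (v.adicCompletion ℚ))) hdisc
      push_cast at h
      exact h
    have ht' : (((E₀.c₆ : ℤ) : AlgebraicClosure (v.adicCompletion ℚ)) * t) ^ 2 = -(((E₀.c₄ : ℤ) : AlgebraicClosure (v.adicCompletion ℚ)) * ((E₀.c₆ : ℤ) : AlgebraicClosure (v.adicCompletion ℚ))) := by
      rw [mul_pow, ht, hγ]; field_simp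
    rw [hT₀]
    field_simp
    linear_combination ht' - hd
  -- `T₀` is a `v`-adic integer
  have hwa₁ : w ((E₀.a₁ : ℤ) : AlgebraicClosure (v.adicCompletion ℚ)) ≤ 1 :=
    (mem_localAbsIntegers_iff_spectralValuation hw).1 (intCast_mem v.localAbsIntegers E₀.a₁)
  have hwC : w ((C : ℤ) : AlgebraicClosure (v.adicCompletion ℚ)) ≤ 1 :=
    (mem_localAbsIntegers_iff_spectralValuation hw).1 (intCast_mem v.localAbsIntegers C)
  have hwT₀ : w T₀ ≤ 1 := by
    by_contra hlt
    rw [not_le] at hlt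
    have hval : w (T₀ ^ 2 + ((E₀.a₁ : ℤ) : AlgebraicClosure (v.adicCompletion ℚ)) * T₀) ≤ 1 := by
      rw [hT₀eq, map_div₀, hw4, div_one]; exact hwC
    have hu1 : w (T₀ + ((E₀.a₁ : ℤ) : AlgebraicClosure (v.adicCompletion ℚ))) = w T₀ := by
      rw [Valuation.map_add_eq_of_lt_left]
      exact lt_of_le_of_lt hwa₁ hlt
    have : w (T₀ ^ 2 + ((E₀.a₁ : ℤ) : AlgebraicClosure (v.adicCompletion ℚ)) * T₀) = w T₀ ^ 2 := by
      rw [show T₀ ^ 2 + ((E₀.a₁ : ℤ) : AlgebraicClosure (v.adicCompletion ℚ)) * T₀ = T₀ * (T₀ + ((E₀.a₁ : ℤ) : AlgebraicClosure (v.adicCompletion ℚ))) by ring,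
        Valuation.map_mul, hu1, pow_two]
    rw [this] at hval
    exact absurd hval (not_le.mpr (one_lt_pow₀ hlt two_ne_zero))
  have hT₀mem : T₀ ∈ v.localAbsIntegers := (mem_localAbsIntegers_iff_spectralValuation hw).2 hwT₀
  -- the Frobenius congruence `τ T₀ ≡ T₀² (mod 𝔐)`
  have hcard : Nat.card (v.adicCompletionIntegers ℚ ⧸
      Ideal.under (v.adicCompletionIntegers ℚ) 𝔐) = 2 := by
    rw [natCard_quotient_under_eq_of_mem_localPrimesAbove v h𝔐,
      WeierstrassCurve.natCard_residueField_adicCompletionIntegers v,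
      Rat.HeightOneSpectrum.primesEquiv_eq_of_natCast_mem v Nat.prime_two h2v]
  have hfrob : w (τ • T₀ - T₀ ^ 2) < 1 := by
    have h := hτ ⟨T₀, hT₀mem⟩
    rw [hcard] at h
    exact (mem_iff_spectralValuation_lt_one hw h𝔐).1 h
  -- `τ t = ± t`
  have hsq : (τ • t) ^ 2 = t ^ 2 := by
    rw [Field.absoluteGaloisGroup.smul_def, ← map_pow, ht, AlgEquiv.commutes]
  have hcases : τ • t = t ∨ τ • t = -t := by
    have h0 : (τ • t - t) * (τ • t + t) = 0 := by
      have : (τ • t - t) * (τ • t + t) = (τ • t) ^ 2 - t ^ 2 := by ring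
      rw [this, hsq, sub_self]
    rcases mul_eq_zero.mp h0 with h | h
    · exact Or.inl (sub_eq_zero.mp h)
    · exact Or.inr (eq_neg_of_add_eq_zero_left h)
  rcases hcases with h | h
  · exfalso
    -- `τ T₀ = T₀`
    have hτT₀ : τ • T₀ = T₀ := by
      rw [hT₀, Field.absoluteGaloisGroup.smul_def, map_div₀, map_sub, map_mul, map_mul, map_mul,
        map_intCast, map_intCast, map_intCast, map_ofNat, ← Field.absoluteGaloisGroup.smul_def, h]
    rw [hτT₀] at hfrob
    -- `T₀ - T₀² = (1 + a₁) T₀ - C/c₄`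
    have hrew : T₀ - T₀ ^ 2 = (1 + ((E₀.a₁ : ℤ) : AlgebraicClosure (v.adicCompletion ℚ))) * T₀ - ((C : ℤ) : AlgebraicClosure (v.adicCompletion ℚ)) / ((E₀.c₄ : ℤ) : AlgebraicClosure (v.adicCompletion ℚ)) := by
      rw [← hT₀eq]; ring
    rw [hrew] at hfrob
    -- `|1 + a₁|_v < 1`
    have hw2 : w (2 : AlgebraicClosure (v.adicCompletion ℚ)) < 1 := by
      have := spectralValuation_natCast_lt_one hw h2v
      rwa [Nat.cast_ofNat] at this
    have hwa : w ((1 + ((E₀.a₁ : ℤ) : AlgebraicClosure (v.adicCompletion ℚ))) * T₀) < 1 := by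
      rw [Valuation.map_mul]
      have h1a : (1 + ((E₀.a₁ : ℤ) : AlgebraicClosure (v.adicCompletion ℚ))) = 2 * (((m + 1 : ℤ)) : AlgebraicClosure (v.adicCompletion ℚ)) := by
        rw [hm]; push_cast; ring
      rw [h1a, Valuation.map_mul]
      calc w (2 : AlgebraicClosure (v.adicCompletion ℚ)) * w (((m + 1 : ℤ)) : AlgebraicClosure (v.adicCompletion ℚ)) * w T₀ ≤ w (2 : AlgebraicClosure (v.adicCompletion ℚ)) * 1 * 1 := by
            gcongr
            · exact (mem_localAbsIntegers_iff_spectralValuation hw).1 (intCast_mem v.localAbsIntegers _)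
        _ < 1 := by rw [mul_one, mul_one]; exact hw2
    -- hence `|C/c₄|_v < 1`, so `2 ∣ C`
    have hwCc : w (((C : ℤ) : AlgebraicClosure (v.adicCompletion ℚ)) / ((E₀.c₄ : ℤ) : AlgebraicClosure (v.adicCompletion ℚ))) < 1 := by
      have e : ((C : ℤ) : AlgebraicClosure (v.adicCompletion ℚ)) / ((E₀.c₄ : ℤ) : AlgebraicClosure (v.adicCompletion ℚ)) =
          (1 + ((E₀.a₁ : ℤ) : AlgebraicClosure (v.adicCompletion ℚ))) * T₀ - ((1 + ((E₀.a₁ : ℤ) : AlgebraicClosure (v.adicCompletion ℚ))) * T₀ -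
            ((C : ℤ) : AlgebraicClosure (v.adicCompletion ℚ)) / ((E₀.c₄ : ℤ) : AlgebraicClosure (v.adicCompletion ℚ))) := by ring
      rw [e]
      exact lt_of_le_of_lt (Valuation.map_sub w _ _) (max_lt hwa hfrob)
    rw [map_div₀, hw4, div_one] at hwCc
    have h2C : (2 : ℤ) ∣ C := by
      by_contra hnd
      have hwC1 : w ((C : ℤ) : AlgebraicClosure (v.adicCompletion ℚ)) = 1 :=
        spectralValuation_intCast_eq_one_of_natCast_mem h2v hw (by rwa [Nat.cast_ofNat])
      rw [hwC1] at hwCc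
      exact lt_irrefl _ hwCc
    -- so the node-tangent quadratic has the root `0` mod `2`: the reduction is split
    apply hns
    haveI : Fact (Nat.Prime 2) := ⟨Nat.prime_two⟩
    refine BirchSwinnertonDyer.Rank1Residual.IntModel.hasSplitMultiplicativeReductionAtPrime_of_intModel_of_root
      (W := W) (E₀ := E₀) hE₀.symm 2 (by exact_mod_cast hΔ) (by exact_mod_cast hc₄) ?_
    have := nodal_root_zero_of_two_dvd E₀ (by rw [hCdef] at h2C; exact h2C)
    exact_mod_cast this
  · exact h

/-- The same in Mathlib's `AlgEquiv` spelling (`toAlgEquiv τ t ≠ t`), as consumed by the strict-core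
argument (hypothesis "`σ t ≠ t`"). [cite: SilvermanATAEC1994, Ch. V Thm. 5.3 (a),(b), Cor. 5.4, Ex. 5.11] -/
theorem frob_apply_sqrt_gamma_ne_two (hmult : W.HasMultiplicativeReductionAtPrime 2)
    (hns : ¬ W.HasSplitMultiplicativeReductionAtPrime 2) (h2v : ((2 : ℕ) : 𝓞 ℚ) ∈ v.asIdeal)
    {𝔐 : Ideal v.localAbsIntegers} (h𝔐 : 𝔐 ∈ v.localPrimesAbove)
    {τ : absoluteGaloisGroup (v.adicCompletion ℚ)}
    (hτ : IsArithFrobAt (v.adicCompletionIntegers ℚ) τ 𝔐)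
    (t : AlgebraicClosure (v.adicCompletion ℚ)) (ht0 : t ≠ 0)
    (ht : t ^ 2 = algebraMap (v.adicCompletion ℚ) (AlgebraicClosure (v.adicCompletion ℚ))
      (algebraMap ℚ (v.adicCompletion ℚ) (-(W.c₄ / W.c₆)))) :
    Field.absoluteGaloisGroup.toAlgEquiv (v.adicCompletion ℚ) τ t ≠ t := by
  rw [← Field.absoluteGaloisGroup.smul_def, frob_smul_sqrt_gamma_eq_neg_two W hmult hns h2v h𝔐 hτ t ht]
  haveI : CharZero (AlgebraicClosure (v.adicCompletion ℚ)) :=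
    charZero_of_injective_algebraMap (algebraMap ℚ (AlgebraicClosure (v.adicCompletion ℚ))).injective
  intro h
  have h2 : (2 : AlgebraicClosure (v.adicCompletion ℚ)) * t = 0 := by linear_combination -h
  rcases mul_eq_zero.mp h2 with h | h
  · exact two_ne_zero h
  · exact ht0 h

/-- **At a multiplicative `2` the absolute inertia group `absInertia ℚ₂` fixes `t = √γ`** (b2b's
`X11a.SelmerCompanion.inertia_fix_sqrt_gamma_two`, stated for `𝔐.inertia`, moved to `absInertia` by
`inertia_eq_absInertia`). [cite: SilvermanATAEC1994, Ch. V Lemma 5.2 (c), Thm. 5.3 (a),(b), Cor. 5.4]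
[cite: NeukirchANT1999, Ch. II §9 Prop. (9.3)] -/
theorem absInertia_fix_sqrt_gamma_two (hmult : W.HasMultiplicativeReductionAtPrime 2)
    (h2v : ((2 : ℕ) : 𝓞 ℚ) ∈ v.asIdeal) :
    ∀ t : AlgebraicClosure (v.adicCompletion ℚ),
      t ^ 2 = algebraMap (v.adicCompletion ℚ) (AlgebraicClosure (v.adicCompletion ℚ))
        (algebraMap ℚ (v.adicCompletion ℚ) (-(W.c₄ / W.c₆))) →
      ∀ σ ∈ absInertia (v.adicCompletion ℚ),
        Field.absoluteGaloisGroup.toAlgEquiv (v.adicCompletion ℚ) σ t = t := by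
  intro t ht σ hσ
  obtain ⟨𝔐, h𝔐⟩ := v.localPrimesAbove_nonempty
  obtain ⟨w, hw⟩ := v.exists_spectralValuation
  have hσ' : σ ∈ 𝔐.inertia (absoluteGaloisGroup (v.adicCompletion ℚ)) := by
    rw [inertia_eq_absInertia hw h𝔐]; exact hσ
  exact X11a.SelmerCompanion.inertia_fix_sqrt_gamma_two W hmult h2v h𝔐 t ht σ hσ'

end Flip

end Summit.BirchSwinnertonDyer.BirchSwinnertonDyer.Theorems.MultTransportAtTwo

end
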